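import Summits.Ventures.HodgeRepro.TwoPowerPairing

/-!
# Fourier analysis on `ℤ/2p` (`p` an odd prime) for a CM profile: constant, two-valued, or paired

Blind re-derivation cell `pub-hodge-repro`, seat `p1` (gen 11).  The companion of `TwoPowerPairing.lean` for
`N = 2p`, `p` an odd prime — the analytic input of `TwoPrimeNoSingleClass.lean` (the family `C₂ × C_{2p}`).

On `ℤ/2p` the odd residues `k` are units EXCEPT `k = p`.  A CM profile `P` (`P(x + p) = 2 − P(x)`, values in
`{0, 1, 2}`) with `∑ᵢ P(x − zᵢ) = 4` therefore satisfies ONE of (`pairing_or_const_twoPrime`):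
* `P ≡ 1` (no odd coefficient at all);
* `P` takes only the values `0` and `2` (the Fourier support is `{0, p}`: `P(x) = 1 + β(−1)^x`, `β = ±1`);
* some unit odd `k` carries `𝓕P(k) ≠ 0`, and the four points split into two pairs each differing by `p`
  (`four_roots_pairs` + `eq_half_of_char_mul_twoPrime`: a unit `k` with `ψ(pk) = −1` turns `ψ(dk) = −1` into `d = p`).
-/

set_option autoImplicit false

open Finset AddChar ZMod
open scoped Pointwise

namespace HodgeRepro.CyclicQuad

variable {N : ℕ} [NeZero N]

/-- On `ℤ/2p`: an odd `k ≠ p` is a unit, so `ψ(pk) = −1` and `ψ(dk) = −1` force `d = p`. -/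
theorem eq_half_of_char_mul_twoPrime {p : ℕ} (hp : p.Prime) (hN : N = 2 * p) (k : ZMod N)
    (hk : stdAddChar ((p : ZMod N) * k) = -1) (hkp : k ≠ (p : ZMod N)) (d : ZMod N)
    (hd : stdAddChar (d * k) = -1) : d = (p : ZMod N) := by
  have hodd : Odd k.val := odd_val_of_char_half_mul hN k hk
  have hcop : Nat.Coprime k.val N := by
    have h2 : Nat.Coprime k.val 2 := Nat.coprime_two_right.mpr hodd
    have hp' : Nat.Coprime k.val p := by
      rw [Nat.coprime_comm, Nat.Prime.coprime_iff_not_dvd hp]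
      rintro ⟨m, hm⟩
      have hlt : k.val < 2 * p := hN ▸ ZMod.val_lt k
      rw [hm, mul_comm 2 p] at hlt
      have hm2 : m < 2 := Nat.lt_of_mul_lt_mul_left hlt
      interval_cases m
      · have hk0 : k = 0 := (ZMod.val_eq_zero k).mp (by rw [hm]; ring)
        rw [hk0, mul_zero, map_zero_eq_one] at hk
        norm_num at hk
      · apply hkp
        rw [← ZMod.natCast_zmod_val k, hm, mul_one]
    have e : Nat.Coprime k.val (2 * p) := Nat.Coprime.mul_right h2 hp'
    exact hN ▸ e
  have hu : ((ZMod.unitOfCoprime k.val hcop : (ZMod N)ˣ) : ZMod N) = k := by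
    rw [ZMod.coe_unitOfCoprime, ZMod.natCast_zmod_val]
  have h1 : d * k = (p : ZMod N) := (stdAddChar_eq_neg_one_iff hN (d * k)).mp hd
  have h2 : (p : ZMod N) * k = (p : ZMod N) := (stdAddChar_eq_neg_one_iff hN _).mp hk
  have h3 : d * k = (p : ZMod N) * k := by rw [h1, h2]
  rw [← hu] at h3
  exact (Units.mul_left_inj _).mp h3

/-- `ψ(pk) = −1` for every `k ≠ 0` in the support of a CM profile on `ℤ/2p`. -/
theorem char_half_mul_eq_neg_one_of_dft {p : ℕ} (hN : N = 2 * p) (P : ZMod N → ℂ)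
    (hP : ∀ x, P (x + p) = 2 - P x) (k : ZMod N) (hk0 : k ≠ 0) (hk : ZMod.dft P k ≠ 0) :
    stdAddChar ((p : ZMod N) * k) = -1 := by
  have hne : stdAddChar ((p : ZMod N) * k) ≠ 1 := fun h1 => hk (dft_eq_zero_of_even_of_half P hP k hk0 h1)
  have hsq : stdAddChar ((p : ZMod N) * k) ^ 2 = 1 := by
    rw [← map_nsmul_eq_pow, nsmul_eq_mul, ← mul_assoc]
    have e : ((2 : ℕ) : ZMod N) * (p : ZMod N) = 0 := by
      rw [← Nat.cast_mul, ← hN, ZMod.natCast_self]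
    rw [e, zero_mul, map_zero_eq_one]
  rcases sq_eq_one_iff.mp hsq with h1 | h1
  · exact absurd h1 hne
  · exact h1

/-- **Constant, two-valued, or paired.**  A `{0,1,2}`-valued CM profile on `ℤ/2p` (`p` an odd prime) with
`∑ᵢ P(x − zᵢ) = 4` is `≡ 1`, or `{0, 2}`-valued, or the four points pair up with differences `p`. -/
theorem pairing_or_const_twoPrime {p : ℕ} (hp : p.Prime) (hp2 : p ≠ 2) (hN : N = 2 * p) (P : ZMod N → ℂ)
    (hP : ∀ x, P (x + p) = 2 - P x) (hv : ∀ x, P x = 0 ∨ P x = 1 ∨ P x = 2) (z : Fin 4 → ZMod N)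
    (hs : ∀ x, ∑ i : Fin 4, P (x - z i) = 4) :
    (∀ x, P x = 1) ∨ (∀ x, P x = 0 ∨ P x = 2) ∨
    ((z 0 - z 1 = (p : ZMod N) ∧ z 2 - z 3 = (p : ZMod N)) ∨
     (z 0 - z 2 = (p : ZMod N) ∧ z 1 - z 3 = (p : ZMod N)) ∨
     (z 0 - z 3 = (p : ZMod N) ∧ z 1 - z 2 = (p : ZMod N))) := by
  by_cases h : ∃ k, k ≠ 0 ∧ k ≠ (p : ZMod N) ∧ ZMod.dft P k ≠ 0
  · right; right
    obtain ⟨k, hk0, hkp, hk⟩ := h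
    have hsum : ∑ i : Fin 4, stdAddChar (-(z i * k)) = 0 :=
      (mul_eq_zero.mp (char_sum_mul_dft_of_sum_four P z hs k hk0)).resolve_right hk
    have hmk := char_half_mul_eq_neg_one_of_dft hN P hP k hk0 hk
    have conv : ∀ i j : Fin 4, stdAddChar (-(z j * k) - -(z i * k)) = -1 → z i - z j = (p : ZMod N) := by
      intro i j h
      apply eq_half_of_char_mul_twoPrime hp hN k hmk hkp
      rw [show (z i - z j) * k = -(z j * k) - -(z i * k) by ring]
      exact h
    rw [Fin.sum_univ_four] at hsum
    rcases four_roots_pairs hsum with ⟨h1, h2⟩ | ⟨h1, h2⟩ | ⟨h1, h2⟩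
    · exact Or.inl ⟨conv 0 1 h1, conv 2 3 h2⟩
    · exact Or.inr (Or.inl ⟨conv 0 2 h1, conv 1 3 h2⟩)
    · exact Or.inr (Or.inr ⟨conv 0 3 h1, conv 1 2 h2⟩)
  · -- the support lies in `{0, p}`: `P` has period `2` and `P(x + 1) = 2 − P(x)`
    have hsupp : ∀ k, k ≠ 0 → k ≠ (p : ZMod N) → ZMod.dft P k = 0 :=
      fun k h1 h2 => by_contra fun h3 => h ⟨k, h1, h2, h3⟩
    have hper2 : ∀ x, P (x + 2) = P x := by
      apply periodic_of_dft
      intro k hk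
      by_cases h1 : k = 0
      · rw [h1, mul_zero, map_zero_eq_one]
      by_cases h2 : k = (p : ZMod N)
      · rw [h2, show (2 : ZMod N) * (p : ZMod N) = ((2 * p : ℕ) : ZMod N) by push_cast; ring, ← hN,
          ZMod.natCast_self, map_zero_eq_one]
      · exact absurd (hsupp k h1 h2) hk
    have hper2n : ∀ (x : ZMod N) (n : ℕ), P (x + 2 * n) = P x := by
      intro x n
      induction n with
      | zero => rw [Nat.cast_zero, mul_zero, add_zero]
      | succ n ih => rw [Nat.cast_succ, mul_add, mul_one, ← add_assoc, hper2, ih]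
    obtain ⟨m, hm⟩ := hp.odd_of_ne_two hp2
    have hsucc : ∀ x, P (x + 1) = 2 - P x := by
      intro x
      have h1 := hP x
      rw [show (p : ZMod N) = 1 + 2 * (m : ZMod N) by rw [hm]; push_cast; ring, ← add_assoc, hper2n] at h1
      exact h1
    have hnat : ∀ n : ℕ, P (n : ZMod N) = P 0 ∨ P (n : ZMod N) = 2 - P 0 := by
      intro n
      induction n with
      | zero => exact Or.inl (by rw [Nat.cast_zero])
      | succ n ih =>
        rw [Nat.cast_succ, hsucc]
        rcases ih with h1 | h1
        · exact Or.inr (by rw [h1])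
        · exact Or.inl (by rw [h1]; ring)
    have hall : ∀ x : ZMod N, P x = P 0 ∨ P x = 2 - P 0 := fun x => by
      rw [← ZMod.natCast_zmod_val x]; exact hnat x.val
    rcases hv 0 with h0 | h0 | h0
    · right; left
      intro x
      rcases hall x with h1 | h1
      · exact Or.inl (by rw [h1, h0])
      · exact Or.inr (by rw [h1, h0]; ring)
    · left
      intro x
      rcases hall x with h1 | h1
      · rw [h1, h0]
      · rw [h1, h0]; ring
    · right; left
      intro x
      rcases hall x with h1 | h1
      · exact Or.inr (by rw [h1, h0])
      · exact Or.inl (by rw [h1, h0]; ring)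

end HodgeRepro.CyclicQuad
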